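import Literature.ModelTheory.FiniteModelTheory.CohomologicalConsistencyIdealReduction
import Literature.ModelTheory.FiniteModelTheory.CohomologicalConsistencyReducibility
import Literature.ModelTheory.FiniteModelTheory.ClosureSize
import Mathlib.Data.Prod.Lex
import Mathlib.Data.Fintype.Sort
import HarnessLib

/-!
# Sparse graphs of small chromatic number fool cohomological `k`-consistency for `3`-colouring
# (the deterministic core of Conneryd–Ghannane–Pang 2025, Theorem 6.1)

Topic `Literature/ModelTheory/FiniteModelTheory`.  Bottom-up formalisation of the named fact
`connerydGhannanePang2025_thm_6_1` (arXiv:2511.17272, Thm. 6.1).  The printed proof of Theorem 6.1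
(§6, "Proof of Theorem 6.1") uses randomness only to secure two properties of `G ∼ 𝒢_{n,d}` —
SPARSITY (Lemma 6.4) and a CHROMATIC WINDOW (Lemma 6.2) — and is otherwise deterministic: order
the vertices by the colour classes of a proper colouring, take the closure operator of Def. 6.6,
check the closure-size bound (Lemma 6.7), satisfiability (Lemma 6.5) and reducibility (Lemma 6.8),
and conclude with Lemma 4.4.  This file ASSEMBLES that deterministic core from the proved
ingredients:

**`graphCohomologicallyKConsistent_of_sparse`.** Let `G` be a finite graph with a linear order
that is a `χ`-ordering of a proper colouring with colours `< c` (`c ≥ 1`), all degrees `≤ d`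
(`d ≥ 1`), `(ℓ, ε)`-sparse with `0 ≤ ε`, `ε(2c+3) ≤ 1/2`, `ε(d+1) < 1/2`.  Then `G` is
cohomologically `k`-consistent with respect to `K₃` (`GraphCohomologicallyKConsistent k G ⊤`,
Ó Conghaile's Definition 5) for every `k` with `c·d^{c-1}·(k + (3k+1)(2c+3)) ≤ ℓ`.

Ingredients: the integral Alekhnovich–Razborov operator and Lemma 4.4
(`graphCohomologicallyKConsistent_of_reducible`), the closure operator `cl`
(`CohomologicalConsistencyClosure.lean`), the size lemma `card_cl_le` (`ClosureSize.lean`),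
reducibility for closed sets `monicExponents_of_isClosed`
(`CohomologicalConsistencyReducibility.lean`), and a numbering `enc` of the variables in which
larger vertices are more significant (`exists_enc`).  Satisfiability is needed only for `cl ∅ = ∅`.

NOT here: the random-graph inputs (Lemmas 6.2, 6.4) and the resulting discharge of the named
fact, which additionally needs the existence of suitable `d`-regular graphs.

## References

* [ConnerydGhannanePang2025] arXiv:2511.17272, §6, proof of Theorem 6.1. READ.
* [CdRNPR25] arXiv:2503.17022, §5–§6 (the same assembly for polynomial calculus, Thm. 30). READ.
-/

noncomputable section

namespace Literature.ModelTheory.FiniteModelTheory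

namespace ConnerydGhannanePang

open Finset
open Literature.RingTheory.MvPolynomial

variable {V : Type*} [LinearOrder V] [Fintype V] {G : SimpleGraph V} [DecidableRel G.Adj]

/-! ### A numbering of the variables in which larger vertices are more significant -/

omit [DecidableRel G.Adj] in
/-- There is a bijection `V × Fin 3 ≃ Fin N` under which LARGER vertices get SMALLER indices
(= more significant variables for Mathlib's lexicographic order): the lexicographic order on
`Vᵒᵈ × Fin 3`.  This realises "`x_{u,i} ≺ x_{v,j}` whenever `u ≺ v`" of the source.
[cite: ConnerydGhannanePang2025, §6 (proof of Thm. 6.1, the order on the variables)] -/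
theorem exists_enc (V : Type*) [LinearOrder V] [Fintype V] :
    ∃ (N : ℕ) (enc : V × Fin 3 ≃ Fin N), ∀ u v : V, u < v → ∀ i j : Fin 3, enc (v, i) < enc (u, j) := by
  let α := Lex (Vᵒᵈ × Fin 3)
  let e : α ≃o Fin (Fintype.card α) := (Fintype.orderIsoFinOfCardEq α rfl).symm
  let f : V × Fin 3 ≃ α := (Equiv.prodCongr OrderDual.toDual (Equiv.refl (Fin 3))).trans toLex
  refine ⟨Fintype.card α, f.trans e.toEquiv, fun u v huv i j => ?_⟩
  show e (toLex (OrderDual.toDual v, i)) < e (toLex (OrderDual.toDual u, j))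
  rw [OrderIso.lt_iff_lt]
  exact Prod.Lex.toLex_lt_toLex.2 (Or.inl (OrderDual.toDual_lt_toDual.2 huv))

/-! ### The closure of the empty set -/

omit [Fintype V] [DecidableRel G.Adj] in
/-- `∅` is closed. [folklore] -/
theorem isClosed_empty : IsClosed G (∅ : Finset V) where
  desc := fun _ h => absurd h (Finset.notMem_empty _)
  hop2 := fun ⟨a, _, _, ha, _⟩ => Finset.notMem_empty a ha
  hop3Path := fun ⟨a, _, _, _, ha, _⟩ => Finset.notMem_empty a ha
  hop3Cycle := fun ⟨a, _, _, ha, _⟩ => Finset.notMem_empty a ha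
  hop4Path := fun ⟨a, _, _, _, _, ha, _⟩ => Finset.notMem_empty a ha
  hop4Cycle := fun ⟨a, _, _, _, ha, _⟩ => Finset.notMem_empty a ha
  lasso := fun ⟨a, _, _, _, ha, _⟩ => Finset.notMem_empty a ha

omit [DecidableRel G.Adj] in
/-- `cl ∅ = ∅`. [folklore] -/
theorem cl_empty : cl G (∅ : Finset V) = ∅ :=
  Finset.subset_empty.1 (cl_subset Finset.Subset.rfl isClosed_empty)

/-! ### The deterministic core of Theorem 6.1 -/

/-- **Sparse graphs of small chromatic number fool cohomological `k`-consistency for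
`3`-colourability** (the deterministic core of Conneryd–Ghannane–Pang, Theorem 6.1; §6, "Proof
of Theorem 6.1", with Lemmas 4.4, 6.5, 6.7, 6.8).  `G` finite, linearly ordered by a `χ`-ordering
of a proper colouring with colours `< c` (`c ≥ 1`), degrees `≤ d` (`d ≥ 1`), `(ℓ, ε)`-sparse with
`0 ≤ ε`, `ε(2c+3) ≤ 1/2` and `ε(d+1) < 1/2`.  Then `G` is cohomologically `k`-consistent w.r.t.
`K₃` whenever `c·d^{c-1}·(k + (3k+1)(2c+3)) ≤ ℓ`. [cite: ConnerydGhannanePang2025, Thm. 6.1 (proof, §6)] -/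
theorem graphCohomologicallyKConsistent_of_sparse {χ : V → ℕ} (hχ : IsChiOrdering G χ) {c : ℕ}
    (hc : ∀ v, χ v < c) (hc1 : 1 ≤ c) {d : ℕ} (hd1 : 1 ≤ d) (hd : ∀ v, G.degree v ≤ d) {ℓ : ℕ}
    {ε : ℝ} (hε : 0 ≤ ε) (hεc : ε * (2 * c + 3) ≤ 1 / 2) (hεd : ε * (d + 1) < 1 / 2)
    (hG : IsSparse G ℓ ε) {k : ℕ} (hk : c * d ^ (c - 1) * (k + (3 * k + 1) * (2 * c + 3)) ≤ ℓ) :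
    GraphCohomologicallyKConsistent k G (⊤ : SimpleGraph (Fin 3)) := by
  obtain ⟨N, enc, henc⟩ := exists_enc V
  -- size of closures of contexts
  have hsize : ∀ U : Finset V, U.card ≤ k → (cl G U).card ≤ ℓ := by
    intro U hU
    have hmono : U.card + (3 * U.card + 1) * (2 * c + 3) ≤ k + (3 * k + 1) * (2 * c + 3) := by
      have := Nat.mul_le_mul_right (2 * c + 3) (by omega : 3 * U.card + 1 ≤ 3 * k + 1)
      omega
    have hcd : 0 < c * d ^ (c - 1) := Nat.mul_pos (by omega) (Nat.pow_pos (by omega))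
    have hUℓ : U.card + (3 * U.card + 1) * (2 * c + 3) ≤ ℓ :=
      le_trans (le_trans (Nat.le_mul_of_pos_left _ hcd) (Nat.mul_le_mul_left _ hmono)) hk
    exact (card_cl_le hχ hc hc1 hd1 hd hε hεc hG U hUℓ).trans
      ((Nat.mul_le_mul_left _ hmono).trans hk)
  refine graphCohomologicallyKConsistent_of_reducible (enc := enc) k (cl G) subset_cl
    (fun U _ a _ => cl_erase_subset U a) ⟨fun _ => 0, fun u hu => ?_⟩ fun U hU a ha α hα hmon => ?_
  · rw [cl_empty] at hu; exact absurd hu (Finset.notMem_empty u)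
  · exact monicExponents_of_isClosed (isClosed_cl (U.erase a)) henc hε hG (hsize U hU) hd hεd hα hmon

end ConnerydGhannanePang

end Literature.ModelTheory.FiniteModelTheory
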